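import Summits.HodgeConjecture.CorCM.Census.DecicWeil23TripleTwoTransitive
import Summits.HodgeConjecture.CorCM.DecicWeil23PairTwoTransitiveTransfer
import Summits.HodgeConjecture.CorCM.DecicWeil23TripleFrameTransfer
import HarnessLib

/-!
# COR-CM — three `(2,3)`-types over one DECIC CM field: FRAME TRANSFER under `2`-TRANSITIVITY (every Galois-balanced weight of a
# product of copies of `E, B₁, B₂, B₃` is balanced under the realised permutations, hence satisfies all sixty `A₅`-equations)

Cell `pub-hodgecm2` (COR-CM), seat b30 gen 23 (2026-08-22); count-neutral own lane DECIC-2T, part 2 (three types), over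
`Census/DecicWeil23TripleTwoTransitive` and `CorCM/DecicWeil23PairTwoTransitiveTransfer` (the finset `realisedPerms e` of
permutations of the pairs induced by automorphisms of `ℂ`: closed under composition and inverse, `2`-transitive under `h2t`).
Theorems only; no definition, no named fact, no `sorry`.

SETTING: that of `CorCM/DecicWeil23TripleFrameTransfer` (slots `OcticWeilOrbit.orbitSlots i₀ i₁ = (k, K, K, K)`, frame `e`, the
three types read at the positions `posT c m` of a shape `c < 8`, model map `toPtT`).  Gen 22 transferred Galois-balance through
the sixty even permutations `permD r`, each assumed realised (`hgal`, from `3`-transitivity).  Here: a Galois-balanced weight is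
balanced under EVERY realised permutation (`modelBalancedPT_of_isGaloisBalancedAlg`, no Galois hypothesis), and under `h2t`
(every ordered pair of distinct conjugate pairs is moved to `(0, 1)` by `Aut(ℂ)`: quintic part `S₅`, `A₅` or `F₂₀`) the realised
permutations are `2`-transitive, so `Census/DecicWeil23TripleTwoTransitive.modelBalancedT_of_modelBalancedPT` yields gen 22's
`ModelBalancedT` (**`modelBalancedT_of_isGaloisBalancedAlg_h2t`**) and the triple chain applies BY NAME.
HONEST FRAMING: nothing about the Hodge conjecture is concluded here; `HC_CM` is not asserted.
[cite: Shimura1998, §18.2 Lemma (i)] [cite: GaoUllmo2025, Thm 3.1 (3.2)] [cite: Pohlmann1968, Thm 1] [cite: DixonMortimer1996, §2.1]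

## References
* [Shimura1998] G. Shimura, *Abelian varieties with complex multiplication and modular functions*, §18.2 Lemma (i).
  [GaoUllmo2025] Z. Gao, E. Ullmo, J. Inst. Math. Jussieu 25 (2025), Thm 3.1 (3.2).  [Pohlmann1968] H. Pohlmann, Ann. of Math.
  88 (1968), Thm 1.  [DixonMortimer1996] J. D. Dixon, B. Mortimer, *Permutation Groups*, GTM 163 (1996), §2.1.
-/

noncomputable section

open CategoryTheory CategoryTheory.Limits NumberField

namespace Summit.HodgeConjecture.CorCM.DecicWeil23Triple

open Literature.AlgebraicGeometry Literature.AlgebraicGeometry.Motives Literature.AlgebraicGeometry.HodgeTheory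
open Literature.AlgebraicGeometry.Pohlmann1968
open Literature.NumberTheory.ComplexMultiplication
open Summit.HodgeConjecture.CorCM.Census.DecicWeil23Triple (PtT inPosT phiPT inl_mem_phiPT inr_mem_phiPT ModelBalancedPT
  ModelBalancedT modelBalancedT_of_modelBalancedPT)
open Summit.HodgeConjecture.CorCM.DecicWeil23Pair (realisedPerms mem_realisedPerms mul_mem_realisedPerms
  twoTransitive_realisedPerms apply_comp_eq_of_realises comp_eq_tau_iff_of_realises)
open Summit.HodgeConjecture.CorCM.OcticWeilOrbit (orbitSlots sigma_cases₃)
open Summit.HodgeConjecture.CorCM.DihedralSexticPairCurvePowers (ncard_sep_eq_card_filter)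

open scoped Classical

section Transfer

variable {I : Type} {Kf : I → Type} [∀ i, Field (Kf i)]
  {i₀ i₁ : I} {e : (Kf i₁ →+* ℂ) ≃ Fin 5 × Bool} {τ : Kf i₀ →+* ℂ}
  (hττ : ComplexEmbedding.conjugate τ ≠ τ) (hk : ∀ σ : Kf i₀ →+* ℂ, σ = τ ∨ σ = ComplexEmbedding.conjugate τ)
  {i : Kf i₀ →+* Kf i₁}
  (he_sign : ∀ s : Kf i₁ →+* ℂ, (e s).2 = true ↔ s.comp i = τ)
  (he_conj : ∀ s : Kf i₁ →+* ℂ, e (ComplexEmbedding.conjugate s) = ((e s).1, !(e s).2))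
  {c : Fin 8} {Φ₄ : ∀ j : Fin 4, CMType (Kf (orbitSlots i₀ i₁ j))}
  (hΦ : ∀ (m : Fin 3) (s : Kf i₁ →+* ℂ), s ∈ (Φ₄ m.succ).1 ↔ (e s).2 = inPosT c m (e s).1)
  (hΨ : ∀ σ : Kf i₀ →+* ℂ, σ ∈ (Φ₄ 0).1 ↔ σ = τ)

include hττ hk he_sign he_conj hΦ hΨ in
/-- **Membership read in the frame** (three slots): for a realiser `ρ` of the permutation `π`, `ρ ∘ x ∈ Φ₄ ↔ toPtT x ∈ phiPT c π`.
[cite: GaoUllmo2025, Thm 3.1 (3.2)] -/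
theorem comp_mem_iff_toPtT_mem_phiPT [NumberField (Kf i₁)] [IsCMField (Kf i₁)] {ρ : ℂ ≃+* ℂ} {π : Equiv.Perm (Fin 5)}
    (hρ : ∀ a : Fin 5, (ρ : ℂ →+* ℂ).comp (e.symm (a, true)) = e.symm (π a, true))
    (x : (j : Fin 4) × (Kf (orbitSlots i₀ i₁ j) →+* ℂ)) :
    (ρ : ℂ →+* ℂ).comp x.2 ∈ (Φ₄ x.1).1 ↔ toPtT e τ x ∈ phiPT c π := by
  rcases sigma_cases₃ x with ⟨σ, rfl⟩ | ⟨m, s, rfl⟩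
  · change (ρ : ℂ →+* ℂ).comp σ ∈ (Φ₄ 0).1 ↔ _
    rw [hΨ, toPtT_zero, inl_mem_phiPT, comp_eq_tau_iff_of_realises hττ hk he_sign ρ hρ σ]
    exact ⟨fun h => decide_eq_true h, fun h => of_decide_eq_true h⟩
  · change (ρ : ℂ →+* ℂ).comp s ∈ (Φ₄ m.succ).1 ↔ _
    rw [hΦ, toPtT_succ, apply_comp_eq_of_realises he_conj ρ hρ s, inr_mem_phiPT]

variable {N : ℕ} (κ : Fin N → Fin 4)

include hττ hk he_sign he_conj hΦ hΨ in
/-- **FRAME TRANSFER, no Galois hypothesis** (three slots): an `Aut(ℂ)`-balanced weight of `X = ⨁_j A₄(κ j)` is balanced, in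
the model of `Census/DecicWeil23Triple`, under EVERY realised permutation of the pairs. [cite: GaoUllmo2025, Thm 3.1 (3.2)]
[cite: Pohlmann1968, Thm 1] -/
theorem modelBalancedPT_of_isGaloisBalancedAlg [NumberField (Kf i₁)] [IsCMField (Kf i₁)]
    {S : Finset ((j : Fin N) × (Kf (orbitSlots i₀ i₁ (κ j)) →+* ℂ))}
    (hS : IsGaloisBalancedAlg (K := fun j => Kf (orbitSlots i₀ i₁ (κ j))) (fun j => Φ₄ (κ j)) S) :
    ModelBalancedPT c (realisedPerms e) (fun x => toPtT e τ ((Sigma.map κ (fun _ => id) :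
      ((j : Fin N) × (Kf (orbitSlots i₀ i₁ (κ j)) →+* ℂ)) → ((m : Fin 4) × (Kf (orbitSlots i₀ i₁ m) →+* ℂ))) x)) S := by
  intro π hπ
  beta_reduce
  obtain ⟨ρ, hρ⟩ := (mem_realisedPerms e π).1 hπ
  have h := hS ρ
  rw [ncard_sep_eq_card_filter, ncard_sep_eq_card_filter] at h
  have key : ∀ x : (j : Fin N) × (Kf (orbitSlots i₀ i₁ (κ j)) →+* ℂ),
      (ρ : ℂ →+* ℂ).comp x.2 ∈ (Φ₄ (κ x.1)).1 ↔ toPtT e τ ((Sigma.map κ (fun _ => id) :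
        ((j : Fin N) × (Kf (orbitSlots i₀ i₁ (κ j)) →+* ℂ)) → ((m : Fin 4) × (Kf (orbitSlots i₀ i₁ m) →+* ℂ))) x)
          ∈ phiPT c π :=
    fun x => comp_mem_iff_toPtT_mem_phiPT hττ hk he_sign he_conj hΦ hΨ hρ ⟨κ x.1, x.2⟩
  rw [Finset.filter_congr fun x _ => key x, Finset.filter_congr fun x _ => (key x).not] at h
  have htot := Finset.card_filter_add_card_filter_not
    (s := S) (fun x => toPtT e τ ((Sigma.map κ (fun _ => id) :
        ((j : Fin N) × (Kf (orbitSlots i₀ i₁ (κ j)) →+* ℂ)) → ((m : Fin 4) × (Kf (orbitSlots i₀ i₁ m) →+* ℂ))) x)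
          ∈ phiPT c π)
  omega

include hττ hk he_sign he_conj hΦ hΨ in
/-- **FRAME TRANSFER under `2`-TRANSITIVITY** (three slots): under `h2t` an `Aut(ℂ)`-balanced weight of `X = ⨁_j A₄(κ j)` satisfies
ALL SIXTY `A₅`-equations `ModelBalancedT` of gen 22's census — the hypothesis `hgal` of `modelBalancedT_of_isGaloisBalancedAlg` is
not needed. [cite: GaoUllmo2025, Thm 3.1 (3.2)] [cite: Pohlmann1968, Thm 1] [cite: DixonMortimer1996, §2.1] -/
theorem modelBalancedT_of_isGaloisBalancedAlg_h2t [NumberField (Kf i₁)] [IsCMField (Kf i₁)]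
    (h2t : ∀ a b : Fin 5, a ≠ b → ∃ ρ : ℂ ≃+* ℂ,
      (ρ : ℂ →+* ℂ).comp (e.symm (a, true)) = e.symm (0, true) ∧ (ρ : ℂ →+* ℂ).comp (e.symm (b, true)) = e.symm (1, true))
    {S : Finset ((j : Fin N) × (Kf (orbitSlots i₀ i₁ (κ j)) →+* ℂ))}
    (hS : IsGaloisBalancedAlg (K := fun j => Kf (orbitSlots i₀ i₁ (κ j))) (fun j => Φ₄ (κ j)) S) :
    ModelBalancedT c (fun x => toPtT e τ ((Sigma.map κ (fun _ => id) :
      ((j : Fin N) × (Kf (orbitSlots i₀ i₁ (κ j)) →+* ℂ)) → ((m : Fin 4) × (Kf (orbitSlots i₀ i₁ m) →+* ℂ))) x)) S :=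
  modelBalancedT_of_modelBalancedPT (mul_mem_realisedPerms e) (twoTransitive_realisedPerms he_sign h2t)
    (modelBalancedPT_of_isGaloisBalancedAlg hττ hk he_sign he_conj hΦ hΨ κ hS)

end Transfer

end Summit.HodgeConjecture.CorCM.DecicWeil23Triple

end
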